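import Summits.CriticalPhenomena.PercolationContinuityZ3.Theorems.PercNearOneGluingNoHeavyPcintBSMRPieces3
import Summits.CriticalPhenomena.PercolationContinuityZ3.Theorems.PercNearOneGluingNoHeavyPcintBSMRFast3
import HarnessLib

/-!
# PCINT lane, PHASE 9 (block renewal with reach-3 pieces): bit-mask glue for the 261 pieces

Cell `prim-pcint`, seat `prim-pcint-1` (gen 17); memo `run/shared/lean/prim/pcint/T-FIBRE-ROUTE.md` §PHASE 9.

The facts about the reach-3 piece table `BSMR.pc3` (…PcintBSMRPieces3) needed by the bit-mask functional of
…PcintBSMRFast3: duplicate-free bit lists, small endpoints, and the instance-ready bridge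
**`BSMR.certLHSz_pc3_eq_certFastM`** (`BSM.certLHSz` with the true shared-key count `BSM.S` equals the cast of
`BSMR.certFastM` on the reward box `[-6,6]^2`).
-/

namespace Summit.CriticalPhenomena.PercolationContinuityZ3.Theorems.Pcint.BSMR

open Summit.CriticalPhenomena.PercolationContinuityZ3.Theorems.Pcint.BSMX
  Summit.CriticalPhenomena.PercolationContinuityZ3.Theorems.Pcint.BSM

set_option maxRecDepth 65536 in
/-- The bit lists of the pieces are duplicate-free. -/
theorem tbits3_nodup : ∀ σ, (tbits (0, 0) (pc3 σ)).Nodup := by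
  decide +kernel

set_option maxRecDepth 65536 in
/-- The piece endpoints lie in `[-3,3]^2` (pair form). -/
theorem pe3_small : ∀ σ, |(tr2 (pend (pc3 σ))).1| ≤ 3 ∧ |(tr2 (pend (pc3 σ))).2| ≤ 3 := by
  decide +kernel

/-- The pieces have length `≤ 6`. -/
theorem length_pc3_le6 : ∀ σ, (pc3 σ).length ≤ 6 := fun σ => by have := length_pc3 σ; omega

/-- Offsets of the reward box `[-6,6]^2` are small in both coordinates. -/
theorem abs_le6_of_mem_boxList6 {y : Fin 2 → ℤ} (hy : y ∈ boxList 2 6) : |y 0| ≤ 6 ∧ |y 1| ≤ 6 := by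
  rw [mem_boxList] at hy
  exact ⟨abs_le.2 (hy 0), abs_le.2 (hy 1)⟩

set_option maxRecDepth 65536 in
/-- The orbit representatives of `[-6,6]^2` lie in the box. -/
theorem reps6_mem_boxList : ∀ y ∈ reps6, y ∈ boxList 2 6 := by
  decide +kernel

/-- **The integer certificate functional of `pc3` equals the bit-mask functional** on the reward box, for piece
records `RS = (W σ, pcode, endpoint, bit list)` and `B ≤ A`. -/
theorem certLHSz_pc3_eq_certFastM {k : ℕ} (W : Fin 261 → ℕ) (RS : List (ℕ × ℕ × (ℤ × ℤ) × List ℕ))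
    (hlen : RS.length = 261)
    (hRS : ∀ σ : Fin 261, RS.getD σ (0, 0, (0, 0), []) =
      (W σ, pcode (tr2 (pend (pc3 σ))), tr2 (pend (pc3 σ)), tbits (0, 0) (pc3 σ)))
    {A B : ℕ} (hBA : B ≤ A) (V0t V1t : ℤ × ℤ → ℕ) {y : Fin 2 → ℤ} (hy : y ∈ boxList 2 6) :
    certLHSz (fun σ => pend (pc3 σ)) (S pc3 k) W k A B 7 (fun u => V0t (tr2 u)) (fun u => V1t (tr2 u)) y =
      ((certFastM RS k A B 7 V0t V1t (tr2 y) (shOf (tr2 y)) (eoff (tr2 y)) : ℕ) : ℤ) :=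
  certLHSz_eq_certFastM pc3 RS hlen W hRS tbits3_nodup length_pc3_le6 pe3_small k A B 7 hBA length_pc3 V0t V1t
    (abs_le6_of_mem_boxList6 hy).1 (abs_le6_of_mem_boxList6 hy).2

end Summit.CriticalPhenomena.PercolationContinuityZ3.Theorems.Pcint.BSMR
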